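import Mathlib
import Summits.QuantumFields.YangMills.Theorems.PencilRigidityWeakCouplingHypercubicLimitStubPressureForcesGap

/-!
# Stub `stub_perpContraction` for the crux `WeakCouplingHypercubicLimit` (line `Sketch`)

**The gap read off the trace excess** (finite-dimensional linear algebra and elementary real
analysis).  Let `T ≥ 0` be a positive operator on `ℝᵈ = EuclideanSpace ℝ (Fin d)` with a unit
fixed vector `Ω` (`T Ω = Ω`), contracting on `Ω^⊥` (`‖T v‖ ≤ ‖v‖` for `v ⊥ Ω`), whose trace
excesses decay exponentially: `tr Tᵐ − 1 ≤ V·C·e^{−μ m}` for all `m ≥ m₀` (any prefactor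
`V > 0`).  Then `T` contracts at rate `e^{−μ}` on `Ω^⊥`: `‖T v‖ ≤ e^{−μ} ‖v‖` for `v ⊥ Ω`.

Proof.  With the rank-one projector `P := |Ω⟩⟨Ω|` and `R := T − P` one has `P² = P` and
`T P = P T = P` (symmetry of `T` and `T Ω = Ω`), hence `Tᵐ = P + Rᵐ` for `m ≥ 1` and
`tr Rᵐ = tr Tᵐ − 1`.  The operator `R` is positive with `‖R x‖ ≤ ‖x‖`
(`R x = T (x − ⟨Ω, x⟩ Ω)`), so in an orthonormal eigenbasis `b` of `R` with eigenvalues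
`ρᵢ ∈ [0, 1]` we get `tr Rᵐ = Σ ρᵢᵐ` and `log (1 + Σ ρᵢᵐ) ≤ Σ ρᵢᵐ ≤ V C e^{−μ m}`.  The
elementary lemma "pressure forces the gap" (if `rᵢ ∈ [0, 1]` and `log (1 + Σ rᵢᵐ) ≤ V C e^{−μ m}`
for all large `m`, then every `rᵢ ≤ e^{−μ}`: otherwise `(rᵢ e^{μ})ᵐ → ∞` while it stays bounded
by `(n + 1) V C`; this is the neighbouring stub `stub_pressureForcesGap`, imported) gives
`ρᵢ ≤ e^{−μ}`; finally, for `v ⊥ Ω`, `T v = R v` and Parseval in the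
eigenbasis gives `‖R v‖² = Σ ρᵢ² ⟨bᵢ, v⟩² ≤ e^{−2μ} ‖v‖²`.  All of this is `[folklore]` linear
algebra over Mathlib (`InnerProductSpace.rankOne`, `LinearMap.trace_eq_sum_inner`,
`OrthonormalBasis.sum_inner_mul_inner` / `sum_sq_inner_right`,
`LinearMap.IsSymmetric.eigenvectorBasis`, `LinearMap.IsPositive.nonneg_eigenvalues`).
-/

noncomputable section

open scoped BigOperators InnerProductSpace

namespace Summit.QuantumFields.YangMills.Theorems.WeakCouplingHypercubicLimit.TraceNormColdPressure

/-- **Perpendicular contraction from trace-excess decay** on a finite-dimensional real inner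
product space `E`: `T ≥ 0`, `‖Ω‖ = 1`, `T Ω = Ω`, `‖T v‖ ≤ ‖v‖` on `Ω^⊥`, `V > 0` and
`tr Tᵐ − 1 ≤ V C e^{−μ m}` for `m ≥ m₀` imply `‖T v‖ ≤ e^{−μ} ‖v‖` on `Ω^⊥`.  Proof: with
`P := |Ω⟩⟨Ω|`, `R := T − P` one has `Tᵐ = P + Rᵐ` (`m ≥ 1`), `R ≥ 0`, `‖R‖ ≤ 1`; in an
eigenbasis of `R` (eigenvalues `ρᵢ ∈ [0, 1]`), `tr Tᵐ − 1 = Σ ρᵢᵐ ≥ log (1 + Σ ρᵢᵐ)`, so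
the neighbouring stub `stub_pressureForcesGap` gives `ρᵢ ≤ e^{−μ}`, and Parseval gives
`‖R v‖ ≤ e^{−μ} ‖v‖`. [folklore] -/
private theorem perpContraction_aux {E : Type*} [NormedAddCommGroup E] [InnerProductSpace ℝ E]
    [FiniteDimensional ℝ E] (T : E →L[ℝ] E) (Ω : E) (μ V C : ℝ) (m₀ : ℕ)
    (hT : T.IsPositive) (hΩ : ‖Ω‖ = 1) (hTΩ : T Ω = Ω)
    (hcon : ∀ v, ⟪Ω, v⟫_ℝ = 0 → ‖T v‖ ≤ ‖v‖) (hV : 0 < V)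
    (htr : ∀ m : ℕ, m₀ ≤ m →
      LinearMap.trace ℝ E (↑(T ^ m) : E →ₗ[ℝ] E) - 1 ≤ V * C * Real.exp (-(μ * m)))
    (v : E) (hv : ⟪Ω, v⟫_ℝ = 0) : ‖T v‖ ≤ Real.exp (-μ) * ‖v‖ := by
  -- basic facts on `T` and `Ω`
  have hΩΩ : ⟪Ω, Ω⟫_ℝ = 1 := by rw [real_inner_self_eq_norm_sq, hΩ, one_pow]
  have hsymT : ∀ x y, ⟪T x, y⟫_ℝ = ⟪x, T y⟫_ℝ := hT.inner_left_eq_inner_right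
  have hΩT : ∀ x, ⟪Ω, T x⟫_ℝ = ⟪Ω, x⟫_ℝ := fun x => by rw [← hsymT, hTΩ]
  -- the rank-one projector `P = |Ω⟩⟨Ω|` and the remainder `R = T - P`
  set P : E →L[ℝ] E := InnerProductSpace.rankOne ℝ Ω Ω with hP
  set R : E →L[ℝ] E := T - P with hR
  have hPapply : ∀ x, P x = ⟪Ω, x⟫_ℝ • Ω := fun x => InnerProductSpace.rankOne_apply Ω Ω x
  have hPΩ : P Ω = Ω := by rw [hPapply, hΩΩ, one_smul]
  have hRapply : ∀ x, R x = T x - ⟪Ω, x⟫_ℝ • Ω := fun x => by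
    rw [hR, sub_apply, hPapply]
  have hRapply' : ∀ x, R x = T (x - ⟪Ω, x⟫_ℝ • Ω) := fun x => by
    rw [map_sub, map_smul, hTΩ, hRapply]
  have hperp : ∀ x, ⟪Ω, x - ⟪Ω, x⟫_ℝ • Ω⟫_ℝ = 0 := fun x => by
    rw [inner_sub_right, real_inner_smul_right, hΩΩ, mul_one, sub_self]
  have hproj : ∀ x, ‖x - ⟪Ω, x⟫_ℝ • Ω‖ ≤ ‖x‖ := fun x => by
    have h : ‖x - ⟪Ω, x⟫_ℝ • Ω‖ ^ 2 = ‖x‖ ^ 2 - ⟪Ω, x⟫_ℝ ^ 2 := by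
      rw [← real_inner_self_eq_norm_sq, ← real_inner_self_eq_norm_sq, inner_sub_left,
        inner_sub_right, inner_sub_right, real_inner_smul_left, real_inner_smul_left,
        real_inner_smul_right, real_inner_smul_right, hΩΩ, real_inner_comm Ω x]
      ring
    have h2 : ‖x - ⟪Ω, x⟫_ℝ • Ω‖ ^ 2 ≤ ‖x‖ ^ 2 := by
      rw [h]; linarith [sq_nonneg ⟪Ω, x⟫_ℝ]
    exact (sq_le_sq₀ (norm_nonneg _) (norm_nonneg _)).mp h2
  -- algebra of `P` and `R`: `P² = P`, `T P = P T = P`, `P R = R P = 0`, `Tᵐ⁺¹ = P + Rᵐ⁺¹`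
  have hPP : P * P = P := by
    ext x
    rw [mul_apply_eq_comp, hPapply x, map_smul, hPΩ]
  have hTP : T * P = P := by
    ext x
    rw [mul_apply_eq_comp, hPapply, map_smul, hTΩ]
  have hPT : P * T = P := by
    ext x
    rw [mul_apply_eq_comp, hPapply, hPapply, hΩT]
  have hPR : P * R = 0 := by rw [hR, mul_sub, hPT, hPP, sub_self]
  have hRP : R * P = 0 := by rw [hR, sub_mul, hTP, hPP, sub_self]
  have hTPR : T = P + R := by rw [hR]; abel
  have hpow : ∀ m : ℕ, T ^ (m + 1) = P + R ^ (m + 1) := by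
    intro m
    induction m with
    | zero => rw [zero_add, pow_one, pow_one, hTPR]
    | succ m ih =>
      calc T ^ (m + 1 + 1) = T ^ (m + 1) * T := pow_succ _ _
        _ = (P + R ^ (m + 1)) * (P + R) := by rw [ih, ← hTPR]
        _ = P * P + P * R + R ^ m * (R * P) + R ^ (m + 1) * R := by
            rw [pow_succ]; noncomm_ring
        _ = P + R ^ (m + 1 + 1) := by
            rw [hPP, hPR, hRP, mul_zero, add_zero, add_zero, ← pow_succ]
  -- `R` is symmetric, positive, and a contraction
  have hRsymm' : ∀ x y, ⟪R x, y⟫_ℝ = ⟪x, R y⟫_ℝ := fun x y => by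
    rw [hRapply, hRapply, inner_sub_left, inner_sub_right, real_inner_smul_left,
      real_inner_smul_right, hsymT, real_inner_comm Ω x]
    ring
  have hRsymm : (↑R : E →ₗ[ℝ] E).IsSymmetric := fun x y => hRsymm' x y
  have hRpos : R.IsPositive := by
    refine (ContinuousLinearMap.isPositive_iff R).mpr ⟨hRsymm, fun x => ?_⟩
    have h1 : ⟪T (x - ⟪Ω, x⟫_ℝ • Ω), ⟪Ω, x⟫_ℝ • Ω⟫_ℝ = 0 := by
      rw [real_inner_smul_right, hsymT, hTΩ, real_inner_comm Ω (x - ⟪Ω, x⟫_ℝ • Ω), hperp,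
        mul_zero]
    have h2 : ⟪R x, x⟫_ℝ = ⟪T (x - ⟪Ω, x⟫_ℝ • Ω), x - ⟪Ω, x⟫_ℝ • Ω⟫_ℝ := by
      rw [hRapply', inner_sub_right, h1, sub_zero]
    rw [h2]
    exact hT.inner_nonneg_left _
  have hRle : ∀ x, ‖R x‖ ≤ ‖x‖ := fun x => by
    rw [hRapply']
    exact (hcon _ (hperp x)).trans (hproj x)
  -- diagonalise `R`
  have hn : Module.finrank ℝ E = Module.finrank ℝ E := rfl
  set b : OrthonormalBasis (Fin (Module.finrank ℝ E)) ℝ E := hRsymm.eigenvectorBasis hn with hb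
  set ρ : Fin (Module.finrank ℝ E) → ℝ := hRsymm.eigenvalues hn with hρ
  have hρ0 : ∀ i, 0 ≤ ρ i := fun i => hRpos.toLinearMap.nonneg_eigenvalues hn i
  have hRb : ∀ i, R (b i) = ρ i • b i := fun i => by
    have h := hRsymm.apply_eigenvectorBasis hn i
    rw [ContinuousLinearMap.coe_coe] at h
    exact h
  have hρ1 : ∀ i, ρ i ≤ 1 := fun i => by
    calc ρ i = ‖R (b i)‖ := by
          rw [hRb, norm_smul, Real.norm_of_nonneg (hρ0 i), b.orthonormal.1 i, mul_one]
      _ ≤ ‖b i‖ := hRle (b i)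
      _ = 1 := b.orthonormal.1 i
  have hRpow : ∀ (m : ℕ) (i : Fin (Module.finrank ℝ E)), (R ^ m) (b i) = ρ i ^ m • b i := by
    intro m i
    induction m with
    | zero => rw [pow_zero, pow_zero, one_smul, one_apply_eq_self]
    | succ m ih => rw [pow_succ, mul_apply_eq_comp, hRb, map_smul, ih, smul_smul, ← pow_succ']
  -- traces: `tr Rᵐ = Σ ρᵢᵐ`, `tr P = 1`, `tr Tᵐ - 1 = Σ ρᵢᵐ` for `m ≥ 1`
  have htrR : ∀ m : ℕ, LinearMap.trace ℝ E (↑(R ^ m) : E →ₗ[ℝ] E) = ∑ i, ρ i ^ m := fun m => by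
    rw [LinearMap.trace_eq_sum_inner _ b]
    refine Finset.sum_congr rfl fun i _ => ?_
    rw [ContinuousLinearMap.coe_coe, hRpow, real_inner_smul_right, real_inner_self_eq_norm_sq,
      b.orthonormal.1 i, one_pow, mul_one]
  have htrP : LinearMap.trace ℝ E (↑P : E →ₗ[ℝ] E) = 1 := by
    rw [LinearMap.trace_eq_sum_inner _ b]
    simp only [ContinuousLinearMap.coe_coe, hPapply, real_inner_smul_right]
    rw [b.sum_inner_mul_inner, hΩΩ]
  have htrT : ∀ m : ℕ, 1 ≤ m →
      LinearMap.trace ℝ E (↑(T ^ m) : E →ₗ[ℝ] E) - 1 = ∑ i, ρ i ^ m := by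
    intro m hm
    obtain ⟨k, rfl⟩ : ∃ k, m = k + 1 := ⟨m - 1, by omega⟩
    rw [hpow k, ContinuousLinearMap.toLinearMap_add, map_add, htrP, htrR]
    ring
  -- pressure forces the gap (neighbouring stub `stub_pressureForcesGap`): every `ρᵢ ≤ e^{-μ}`
  have hρle : ∀ i, ρ i ≤ Real.exp (-μ) := by
    refine stub_pressureForcesGap _ ρ V C μ (max m₀ 1) (fun i => ⟨hρ0 i, hρ1 i⟩) hV ?_
    intro m hm
    have hm0 : m₀ ≤ m := le_of_max_le_left hm
    have hm1 : 1 ≤ m := le_of_max_le_right hm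
    have hS0 : 0 ≤ ∑ i, ρ i ^ m := Finset.sum_nonneg fun i _ => pow_nonneg (hρ0 i) _
    have hlog : Real.log (1 + ∑ i, ρ i ^ m) ≤ ∑ i, ρ i ^ m := by
      have := Real.log_le_sub_one_of_pos (by linarith : (0 : ℝ) < 1 + ∑ i, ρ i ^ m)
      linarith
    calc Real.log (1 + ∑ i, ρ i ^ m) ≤ ∑ i, ρ i ^ m := hlog
      _ = LinearMap.trace ℝ E (↑(T ^ m) : E →ₗ[ℝ] E) - 1 := (htrT m hm1).symm
      _ ≤ V * C * Real.exp (-(μ * m)) := htr m hm0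
      _ = V * C * Real.exp (-μ * m) := by rw [neg_mul]
  -- conclusion: `T v = R v`, and Parseval in the eigenbasis of `R`
  have hTv : T v = R v := by rw [hRapply, hv, zero_smul, sub_zero]
  have hsq : ‖R v‖ ^ 2 ≤ (Real.exp (-μ) * ‖v‖) ^ 2 := by
    rw [← b.sum_sq_inner_right (R v), mul_pow, ← b.sum_sq_inner_right v, Finset.mul_sum]
    refine Finset.sum_le_sum fun i _ => ?_
    rw [← hRsymm' (b i) v, hRb, real_inner_smul_left, mul_pow]
    exact mul_le_mul_of_nonneg_right (pow_le_pow_left₀ (hρ0 i) (hρle i) 2) (sq_nonneg _)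
  rw [hTv]
  exact (sq_le_sq₀ (norm_nonneg _) (by positivity)).mp hsq

/-- `stub_perpContraction` (S2) — **the gap read off the trace excess** (finite-dimensional):
`T ≥ 0` on `ℝᵈ` with a normalised fixed vector `Ω`, contracting on `Ω^⊥`; if
`tr Tᵐ − 1 ≤ V·C·e^{−μ m}` for all `m ≥ m₀` (any prefactor `V > 0`), then `‖T v‖ ≤ e^{−μ} ‖v‖`
on `Ω^⊥` (eigenbasis of `R := T − |Ω⟩⟨Ω|`, `tr Rᵐ = Σ ρᵢᵐ = tr Tᵐ − 1`, then "pressure forces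
the gap"). [folklore] -/
theorem stub_perpContraction :
    ∀ (d : ℕ) (T : EuclideanSpace ℝ (Fin d) →L[ℝ] EuclideanSpace ℝ (Fin d)) (Ω : EuclideanSpace ℝ (Fin d)) (μ V C : ℝ) (m₀ : ℕ),
      T.IsPositive → ‖Ω‖ = 1 → T Ω = Ω → (∀ v, inner ℝ Ω v = 0 → ‖T v‖ ≤ ‖v‖) → 0 < V →
      (∀ m : ℕ, m₀ ≤ m → LinearMap.trace ℝ _ (↑(T ^ m) : EuclideanSpace ℝ (Fin d) →ₗ[ℝ] EuclideanSpace ℝ (Fin d)) - 1 ≤ V * C * Real.exp (-(μ * m))) →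
      ∀ v, inner ℝ Ω v = 0 → ‖T v‖ ≤ Real.exp (-μ) * ‖v‖ := by
  intro d T Ω μ V C m₀ hT hΩ hTΩ hcon hV htr v hv
  exact perpContraction_aux T Ω μ V C m₀ hT hΩ hTΩ hcon hV htr v hv

end Summit.QuantumFields.YangMills.Theorems.WeakCouplingHypercubicLimit.TraceNormColdPressure

end
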